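import Literature.Probability.Percolation.SlabRSWGluingExtB
import Literature.Probability.Percolation.SlabRSWGluingOrient
import Literature.Probability.Percolation.SlabRSWTheorem314
import HarnessLib

/-!
# Newman–Tassion–Wu 2017, Theorem 3.14 — Case 2: the event `𝓑₂` and the input `(H2)`

Topic: `Literature/Probability/Percolation`. The tree's assembly of NTW's RSW Theorem 3.14
(`SlabRSWTheorem314.lean`, `NTW17.thm314_of_cases`) takes an ARBITRARY family of events `𝓑₂ n`
together with two hypotheses: `(H2)` (`P[𝓑₂ n] ≥ x ⇒ P[𝓑₁ n] ≥ y(x)` eventually, NTW's Case 2) and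
`(H3)` (the exploration step, Case 3). This file fixes `𝓑₂` to NTW's own event (p. 17: "`𝓑₂` the
event that there exists an open path from `Y` to `𝒩(Γ̄, 3r)` inside `R`", `Γ = Γ_min^S(X, L(S))`)
— in the tree's vocabulary: `{X ⟷^S L(S)} ∩ {Ȳ ⟷^{R̄} 𝒩(Γ̄, ρ)}` with `Γ` the tree's minimal path
— and PROVES `(H2)` for it, by the gluing lemma GL (Thm. 3.7, linear regime, `S ⊊ R`:
`real_evAB_inter_evNear_le_ext`).

The tree's routing runs to the right/top and its minimal path is taken for the non-symmetric key
`vKey`; so the event is DEFINED through the reflection `σ : (x, y) ↦ (7n - x, y)` of NTW's picture: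
`S' = σS = [0,7n]×[0,8n-1] ⊆ R' = σR = [0,14n]×[0,13n-1]`, `A = σX = {0}×[0,4n-1]`,
`B = σL(S) = {7n}×[0,8n-1]` (the right side of `S'`), `C = σY = {0}×[5n,13n-1]` — the
extended-rectangle setting `case2Setup n` — and `𝓑₂ n = σ·(A ⟷^{S'} B ∩ C̄ ⟷^{R̄'} 𝒩(Γ̄', ρ))`
(`evCase2 k ρ n`). The probabilities of `𝓑₁`, `𝒜` are `σ`-invariant, so this is NTW's Case 2 up to
the (immaterial) choice of the order defining `Γ_min`.

* `case2Setup n hn` — the setting; `evCase2 k ρ n` — the event `𝓑₂ n` (radius `ρ`, any `ρ ≥ 2`);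
* `real_evCase2_le` — `P[𝓑₂ n] ≤ (1 + λ^s) · P[Y ⟷^R X]` for `n ≥ 4ρ + 8`;
* **`thm314_hCase2`** — `(H2)` in the exact shape of the hypothesis `hCase2` of `thm314_of_cases`;
* `thm314_of_case3` — Theorem 3.14 assembled with Case 2 discharged: (3.38) and `(H3)` for
  `𝓑₂ = evCase2 k ρ₂` give `inf_m f(2m,m) > 0`.

## Sources

* C. M. Newman, V. Tassion, W. Wu, *Critical percolation and the minimal spanning tree in slabs*,
  Comm. Pure Appl. Math. 70 (2017), arXiv:1512.09107: §3.5, proof of Theorem 3.14, the events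
  `𝓑₁, 𝓑₂` and Case 2 ((3.45)–(3.46), p. 17); Theorem 3.7 with Remark 3 [NewmanTassionWu2017].
-/

noncomputable section

namespace Literature.Probability.Percolation

open MeasureTheory LatticeModels SimpleGraph

namespace NTW17

variable {k : ℕ}

/-! ## The setting of Case 2, reflected -/

/-- **The Case-2 gluing data of Theorem 3.14, reflected by `x ↦ 7n - x`**: `S' = [0,7n]×[0,8n-1]`,
`R' = [0,14n]×[0,13n-1]`, `A = {0}×[0,4n-1]` (`= σX`), `B = {7n}×[0,8n-1]` (`= σ L(S)`, the right
side of `S'`), `C = {0}×[5n,13n-1]` (`= σY`). [cite: NewmanTassionWu2017, §3.5 (proof of Theorem 3.14, S, R, X, Y and Case 2)] -/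
def case2Setup (n : ℕ) (hn : 1 ≤ n) : ExtSetup where
  a := 0
  b := 7 * n
  c := 0
  d := 8 * n - 1
  b' := 14 * n
  d' := 13 * n - 1
  A := sideSeg 0 0 (4 * n - 1)
  C := sideSeg 0 (5 * n) (13 * n - 1)
  hab := by omega
  hcd := by omega
  hbb' := by omega
  hdd' := by omega
  hA := by
    intro z hz
    rw [sideSeg, Set.mem_setOf_eq] at hz
    rw [mem_boxR_iff]
    omega
  hAB := by
    intro z hz
    rw [sideSeg, Set.mem_setOf_eq] at hz
    omega
  hC := by
    intro z hz
    rw [sideSeg, Set.mem_setOf_eq] at hz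
    rw [mem_boxR_iff]
    omega

/-- `S' = [0,7n]×[0,8n-1]`. [cite: NewmanTassionWu2017, §3.5 (S)] -/
theorem case2Setup_S {n : ℕ} (hn : 1 ≤ n) : (case2Setup n hn).S = boxR 0 (7 * n) 0 (8 * n - 1) := rfl

/-- `R' = [0,14n]×[0,13n-1]`. [cite: NewmanTassionWu2017, §3.5 (R)] -/
theorem case2Setup_R {n : ℕ} (hn : 1 ≤ n) : (case2Setup n hn).R = boxR 0 (14 * n) 0 (13 * n - 1) := rfl

/-- `A = {0}×[0,4n-1]`. [cite: NewmanTassionWu2017, §3.5 (X)] -/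
theorem case2Setup_A {n : ℕ} (hn : 1 ≤ n) : (case2Setup n hn).A = sideSeg 0 0 (4 * n - 1) := rfl

/-- `C = {0}×[5n,13n-1]`. [cite: NewmanTassionWu2017, §3.5 (Y)] -/
theorem case2Setup_C {n : ℕ} (hn : 1 ≤ n) : (case2Setup n hn).C = sideSeg 0 (5 * n) (13 * n - 1) := rfl

/-- `B = {7n}×[0,8n-1]`. [cite: NewmanTassionWu2017, §3.5 (L(S))] -/
theorem case2Setup_B {n : ℕ} (hn : 1 ≤ n) : (case2Setup n hn).B = sideSeg (7 * n) 0 (8 * n - 1) := by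
  ext z
  rw [ExtSetup.mem_B_iff, ExtSetup.mem_S_iff, sideSeg, Set.mem_setOf_eq]
  simp only [case2Setup]
  omega

/-- `A` and `C` are far apart: `dist*(A, C) = n + 1 > 4ρ + 8` once `n ≥ 4ρ + 8`.
[cite: NewmanTassionWu2017, §3.2 (Theorem 3.7, "A, B, C … at least sup-norm distance r+2 apart")] -/
theorem case2Setup_sep {n ρ : ℕ} (hn : 1 ≤ n) (hnρ : 4 * ρ + 8 ≤ n) :
    ∀ a' ∈ (case2Setup n hn).A, ∀ c' ∈ (case2Setup n hn).C, c' ∉ sqBox a' (4 * ρ + 8) := by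
  intro a' ha' c' hc' h
  rw [case2Setup_A, sideSeg, Set.mem_setOf_eq] at ha'
  rw [case2Setup_C, sideSeg, Set.mem_setOf_eq] at hc'
  rw [mem_sqBox_iff'] at h
  push_cast at h
  omega

/-! ## The event `𝓑₂` -/

/-- **NTW's event `𝓑₂`** of the proof of Theorem 3.14 ("there exists an open path from `Y` to
`𝒩(Γ̄, 3r)` inside `R`", with `Γ = Γ_min^S(X, L(S))`), in the tree's vocabulary and pulled back
through the reflection `σ = planarReflect (7n)`: `ω ∈ 𝓑₂ n` iff `σ·ω ∈ {A ⟷^{S'} B} ∩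
{C̄ ⟷^{R̄'} 𝒩(Γ̄', ρ)}` for the reflected setting `case2Setup n` (`Γ'` the tree's minimal path from
`Ā` to `B̄` inside `S̄'`); the radius `ρ` is a parameter (NTW: `3r`). Empty for `n = 0`.
[cite: NewmanTassionWu2017, §3.5 (proof of Theorem 3.14, the event 𝓑₂)] -/
def evCase2 (k ρ n : ℕ) : Set (BondConfig (slab 3 k)) :=
  if hn : 1 ≤ n then
    slabRelabel k (planarReflect (7 * (n : ℤ))) ⁻¹'
      ((case2Setup n hn).Q.evAB k ∩ (case2Setup n hn).Q.evNear k ρ)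
  else ∅

/-- Unfolding `𝓑₂ n` for `n ≥ 1`. [cite: NewmanTassionWu2017, §3.5 (proof of Theorem 3.14, 𝓑₂)] -/
theorem evCase2_eq {ρ n : ℕ} (hn : 1 ≤ n) :
    evCase2 k ρ n = slabRelabel k (planarReflect (7 * (n : ℤ))) ⁻¹'
      ((case2Setup n hn).Q.evAB k ∩ (case2Setup n hn).Q.evNear k ρ) := by
  rw [evCase2, dif_pos hn]

/-- Membership in `𝓑₂ n` for `n ≥ 1`. [cite: NewmanTassionWu2017, §3.5 (proof of Theorem 3.14, 𝓑₂)] -/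
theorem mem_evCase2_iff {ρ n : ℕ} (hn : 1 ≤ n) {ω : BondConfig (slab 3 k)} :
    ω ∈ evCase2 k ρ n ↔ slabRelabel k (planarReflect (7 * (n : ℤ))) ω ∈
      (case2Setup n hn).Q.evAB k ∩ (case2Setup n hn).Q.evNear k ρ := by
  rw [evCase2_eq hn]; rfl

/-! ## The reflection `σ` on the sets of Theorem 3.14 -/

/-- `σR' = R = [-7n,7n]×[0,13n-1]`. [cite: NewmanTassionWu2017, §3.5 (R)] -/
theorem image_reflect_R' (n : ℕ) :
    planarReflect (7 * (n : ℤ)) '' boxR 0 (14 * n) 0 (13 * n - 1) = boxR (-(7 * n)) (7 * n) 0 (13 * n - 1) := by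
  rw [image_planarReflect_eq]
  ext z
  simp only [Set.mem_setOf_eq, mem_boxR_iff]
  omega

/-- `σC = Y = {7n}×[5n,13n-1]`. [cite: NewmanTassionWu2017, §3.5 (Y)] -/
theorem image_reflect_C (n : ℕ) :
    planarReflect (7 * (n : ℤ)) '' sideSeg 0 (5 * n) (13 * n - 1) = sideSeg (7 * n) (5 * n) (13 * n - 1) := by
  rw [image_planarReflect_eq]
  ext z
  simp only [Set.mem_setOf_eq, sideSeg]
  omega

/-- `σA = X = {7n}×[0,4n-1]`. [cite: NewmanTassionWu2017, §3.5 (X)] -/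
theorem image_reflect_A (n : ℕ) :
    planarReflect (7 * (n : ℤ)) '' sideSeg 0 0 (4 * n - 1) = sideSeg (7 * n) 0 (4 * n - 1) := by
  rw [image_planarReflect_eq]
  ext z
  simp only [Set.mem_setOf_eq, sideSeg]
  omega

/-- **The glued connection is `𝓑₁`**: `P[C ⟷^{R'} A] = P[Y ⟷^R X]`.
[cite: NewmanTassionWu2017, §3.5 (proof of Theorem 3.14, 𝓑₁ and (3.45))] -/
theorem real_evCA_case2 {n : ℕ} (hn : 1 ≤ n) (p : unitInterval) :
    (bondPercolation (slabGraph 3 k) p).real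
        (slabConn k (case2Setup n hn).R (case2Setup n hn).C (case2Setup n hn).A) =
      (bondPercolation (slabGraph 3 k) p).real (slabConn k (boxR (-(7 * n)) (7 * n) 0 (13 * n - 1))
        (sideSeg (7 * n) (5 * n) (13 * n - 1)) (sideSeg (7 * n) 0 (4 * n - 1))) := by
  rw [case2Setup_R, case2Setup_C, case2Setup_A, ← image_reflect_R' n, ← image_reflect_C n,
    ← image_reflect_A n]
  exact (real_slabConn_image k (planarReflect (7 * (n : ℤ))) (planarAdj_planarReflect _) p _ _ _).symm

/-! ## `(H2)`: Case 2 of Theorem 3.14 -/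

/-- **`P[𝓑₂ n] ≤ (1 + λ^s) · P[𝓑₁ n]`** for `n ≥ 4ρ + 8` (`k ≥ 1`, `ρ ≥ 2`, `0 < p < 1`), with
`λ = 2/min{p, 1-p}`, `s = 3(5k+4)(12ρ+13)²`: the gluing lemma GL (Thm. 3.7, linear regime) in the
reflected extended rectangle, transported back by `σ`.
[cite: NewmanTassionWu2017, §3.5 (proof of Theorem 3.14, Case 2, (3.45)); Theorem 3.7 with Remark 3] -/
theorem real_evCase2_le (hk : 1 ≤ k) {ρ : ℕ} (hρ : 2 ≤ ρ) (p : unitInterval) (hp0 : 0 < (p : ℝ))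
    (hp1 : (p : ℝ) < 1) {n : ℕ} (hnρ : 4 * ρ + 8 ≤ n) :
    (bondPercolation (slabGraph 3 k) p).real (evCase2 k ρ n) ≤
      (1 + (2 / min (p : ℝ) (1 - p)) ^ (3 * ((5 * k + 4) * (2 * (2 * (3 * ρ + 3)) + 1) ^ 2))) *
        (bondPercolation (slabGraph 3 k) p).real (slabConn k (boxR (-(7 * n)) (7 * n) 0 (13 * n - 1))
          (sideSeg (7 * n) (5 * n) (13 * n - 1)) (sideSeg (7 * n) 0 (4 * n - 1))) := by
  have hn : 1 ≤ n := by omega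
  rw [evCase2_eq hn, real_preimage_slabRelabel k _ (planarAdj_planarReflect _), ← real_evCA_case2 hn p]
  exact real_evAB_inter_evNear_le_ext (case2Setup n hn) hk hρ (case2Setup_sep hn hnρ) p hp0 hp1

/-- **NTW 2017, Theorem 3.14, Case 2 — the input `(H2)` of the tree's assembly `thm314_of_cases`,
for `𝓑₂ = evCase2 k ρ`**: for every `x > 0` there are `y > 0` (namely `x/(1 + λ^s)`) and `n₂`
(namely `4ρ + 8`) such that for `n ≥ n₂`, `x ≤ P[𝓑₂ n]` implies `y ≤ P[Y ⟷^R X]`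
(`R = [-7n,7n]×[0,13n-1]`, `Y = {7n}×[5n,13n-1]`, `X = {7n}×[0,4n-1]`).
[cite: NewmanTassionWu2017, §3.5 (proof of Theorem 3.14, Case 2, (3.45)–(3.46))] -/
theorem thm314_hCase2 (hk : 1 ≤ k) {ρ : ℕ} (hρ : 2 ≤ ρ) (p : unitInterval) (hp0 : 0 < (p : ℝ))
    (hp1 : (p : ℝ) < 1) :
    ∀ x : ℝ, 0 < x → ∃ y : ℝ, 0 < y ∧ ∃ n₂ : ℕ, ∀ n : ℕ, n₂ ≤ n →
      x ≤ (bondPercolation (slabGraph 3 k) p).real (evCase2 k ρ n) →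
      y ≤ (bondPercolation (slabGraph 3 k) p).real (slabConn k (boxR (-(7 * n)) (7 * n) 0 (13 * n - 1))
        (sideSeg (7 * n) (5 * n) (13 * n - 1)) (sideSeg (7 * n) 0 (4 * n - 1))) := by
  intro x hx
  set Λ : ℝ := 1 + (2 / min (p : ℝ) (1 - p)) ^ (3 * ((5 * k + 4) * (2 * (2 * (3 * ρ + 3)) + 1) ^ 2))
    with hΛ
  have hΛpos : 0 < Λ := by positivity
  refine ⟨x / Λ, div_pos hx hΛpos, 4 * ρ + 8, fun n hn hxB => ?_⟩
  have h := real_evCase2_le hk hρ p hp0 hp1 hn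
  rw [← hΛ] at h
  rw [div_le_iff₀ hΛpos]
  calc x ≤ _ := hxB
    _ ≤ _ := h
    _ = _ := mul_comm _ _

/-- **NTW 2017, Theorem 3.14 with Case 2 discharged**: slab `S_k` (`k ≥ 1`), `ρ ≥ 4` (the GL0 radius
of Case 1), `ρ₂ ≥ 2` (the radius of `𝓑₂`), `0 < p < 1`, `0 < c₀ ≤ 1`; assume (3.38) `c₀ ≤ f_p(m,2m)`
for all `m ≥ 1` and the Case-3 input `(H3)` for `𝓑₂ = evCase2 k ρ₂`. Then `∃ c' > 0, ∀ m ≥ 1,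
c' ≤ f_p(2m, m)`. [cite: NewmanTassionWu2017, Theorem 3.14 (proof, (3.39)–(3.54), Case 2 = (3.45)–(3.46))] -/
theorem thm314_of_case3 (hk : 1 ≤ k) {ρ : ℕ} (hρ : 4 ≤ ρ) {ρ₂ : ℕ} (hρ₂ : 2 ≤ ρ₂) (p : unitInterval)
    (hp0 : 0 < (p : ℝ)) (hp1 : (p : ℝ) < 1) {c₀ : ℝ} (hc₀ : 0 < c₀) (hc₁ : c₀ ≤ 1)
    (h338 : ∀ m : ℕ, 1 ≤ m → c₀ ≤ (bondPercolation (slabGraph 3 k) p).real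
      (slabConn k (boxR 0 m 0 (2 * m)) {z | z.1 = 0} {z | z.1 = m}))
    (hCase3 : ∀ x : ℝ, 0 < x → ∃ y : ℝ, 0 < y ∧ ∃ n₃ : ℕ, ∀ n : ℕ, n₃ ≤ n →
      x ≤ (bondPercolation (slabGraph 3 k) p).real
        ((slabConn k (boxR 0 (7 * n) 0 (8 * n - 1)) {z | z.1 = 0} (sideSeg (7 * n) 0 (4 * n - 1)) ∩
            slabConn k (boxR (-(7 * n)) (7 * n) 0 (13 * n - 1)) {z | z.2 = 0} (sideSeg (7 * n) (5 * n) (13 * n - 1))) ∩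
          (slabConn k (boxR (-(7 * n)) (7 * n) 0 (13 * n - 1)) (sideSeg (7 * n) (5 * n) (13 * n - 1))
            (sideSeg (7 * n) 0 (4 * n - 1)))ᶜ ∩ (evCase2 k ρ₂ n)ᶜ) →
      y ≤ (bondPercolation (slabGraph 3 k) p).real
        (slabConn k (boxR 0 (14 * n) 0 (13 * n)) {z | z.1 = 0} {z | z.1 = 14 * n})) :
    ∃ c' : ℝ, 0 < c' ∧ ∀ m : ℕ, 1 ≤ m → c' ≤ (bondPercolation (slabGraph 3 k) p).real
      (slabConn k (boxR 0 (2 * m) 0 m) {z | z.1 = 0} {z | z.1 = 2 * m}) :=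
  thm314_of_cases hk hρ p hp0 hp1 hc₀ hc₁ h338 (evCase2 k ρ₂) (thm314_hCase2 hk hρ₂ p hp0 hp1) hCase3

end NTW17

end Literature.Probability.Percolation
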